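import Mathlib
import Summits.Ventures.PercRepro2.Defs
import Summits.Ventures.PercRepro2.Independence
import Summits.Ventures.PercRepro2.Harris
import Summits.Ventures.PercRepro2.Graph
import Summits.Ventures.PercRepro2.Exploration
import Summits.Ventures.PercRepro2.Events
import Summits.Ventures.PercRepro2.HCov
import Summits.Ventures.PercRepro2.HCovFns
import Summits.Ventures.PercRepro2.HCovSwap
import Summits.Ventures.PercRepro2.PendantRoot
import Summits.Ventures.PercRepro2.PendantO
import Summits.Ventures.PercRepro2.PendantB
import Summits.Ventures.PercRepro2.PendantBRow
import Summits.Ventures.PercRepro2.LeafStep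
import Summits.Ventures.PercRepro2.LeafStepT0
import Summits.Ventures.PercRepro2.LeafChain
import Summits.Ventures.PercRepro2.LeafEnds
import Summits.Ventures.PercRepro2.LeafPlus
import Summits.Ventures.PercRepro2.LeafEndsPlus
import Summits.Ventures.PercRepro2.LeafDelete
import Summits.Ventures.PercRepro2.LeafDeletePath
import Summits.Ventures.PercRepro2.LeafDeleteTriple

/-!
# Pruning unmarked leaves; `(HCOV)⁺` on pendant trees (blind cell PercRepro2, p1 g8)

`Pruning M ends ends′`: `ends′` is obtained from `ends` by repeatedly re-pointing the edge of a leaf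
`ℓ ∉ M` to a loop (`LeafDelete`). For `M ⊇ {o, b, a₁, a₂, a₃}` every quantity of the marking is
unchanged (`HCovTriple_pruning`, `HCov_pruning`). Hence **if, after pruning unmarked leaves, `a₃`
is the end of a pendant path attached to a marked vertex — i.e. `a₃` lies in a pendant tree hanging
from `o`, `b`, `a₁` or `a₂` — then `(HCOV)⁺` holds at `a₃`** (`HCovTriple_pruned_pendantPath_marked`),
for all weights: the weighted (HCOV) line is closed on pendant trees attached to the marked vertices,
with `(Q1)` carried along.
-/

namespace Summit.Ventures.PercRepro2

open UnionCluster CovForm PendantRoot PendantO LeafStep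

namespace LeafDelete

variable {V : Type*} {E : Type*} [DecidableEq E]

/-- `Pruning M ends ends′`: `ends′` arises from `ends` by re-pointing, one at a time, the edge of a
leaf not in `M` to a loop. -/
inductive Pruning (M : Finset V) : (E → Sym2 V) → (E → Sym2 V) → Prop
  | refl (ends : E → Sym2 V) : Pruning M ends ends
  | step {ends ends' : E → Sym2 V} {f : E} {ℓ w : V} (h : Pruning M ends ends')
      (hf : ends' f = s(ℓ, w)) (hleaf : ∀ e, ℓ ∈ ends' e → e = f) (hℓw : ℓ ≠ w) (hℓ : ℓ ∉ M) :
      Pruning M ends (Function.update ends' f s(ℓ, ℓ))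

variable [Fintype E] [Fintype V] [DecidableEq V] {R : Type*} [Field R] [LinearOrder R]
  [IsStrictOrderedRing R] (p : E → R)

omit [Fintype V] [IsStrictOrderedRing R] in
/-- (HCOV) is unchanged by pruning leaves outside the marking. -/
theorem HCov_pruning {ends ends' : E → Sym2 V} {o a₁ a₂ a₃ b : V}
    (h : Pruning {o, b, a₁, a₂, a₃} ends ends') :
    HCov p ends' o a₁ a₂ a₃ b ↔ HCov p ends o a₁ a₂ a₃ b := by
  induction h with
  | refl => exact Iff.rfl
  | step _ hf hleaf hℓw hℓ ih =>
    simp only [Finset.mem_insert, Finset.mem_singleton, not_or] at hℓ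
    obtain ⟨ho, hb, h1, h2, h3⟩ := hℓ
    rw [HCov_update_loop p hf hleaf hℓw (Ne.symm ho) (Ne.symm h1) (Ne.symm h2) (Ne.symm h3)
      (Ne.symm hb)]
    exact ih

omit [Fintype V] [IsStrictOrderedRing R] in
/-- The triple is unchanged by pruning leaves outside the marking. -/
theorem HCovTriple_pruning {ends ends' : E → Sym2 V} {o a₁ a₂ a₃ b : V}
    (h : Pruning {o, b, a₁, a₂, a₃} ends ends') :
    HCovTriple p ends' o a₁ a₂ a₃ b ↔ HCovTriple p ends o a₁ a₂ a₃ b := by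
  induction h with
  | refl => exact Iff.rfl
  | step _ hf hleaf hℓw hℓ ih =>
    simp only [Finset.mem_insert, Finset.mem_singleton, not_or] at hℓ
    obtain ⟨ho, hb, h1, h2, h3⟩ := hℓ
    rw [HCovTriple_update_loop p hf hleaf hℓw (Ne.symm ho) (Ne.symm h1) (Ne.symm h2) (Ne.symm h3)
      (Ne.symm hb)]
    exact ih

/-- **`(HCOV)⁺` on pendant trees**: if after pruning unmarked leaves `a₃` is a vertex of a pendant
path attached to a marked vertex `x ∈ {o, b, a₁, a₂}`, then `(HCOV) ∧ (LEAF) ∧ (Q1)` hold at `a₃`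
in the original graph (all weights). -/
theorem HCovTriple_pruned_pendantPath_marked (hp : IsProbVec p) {ends ends' : E → Sym2 V}
    {o a₁ a₂ a₃ b x : V} (hpr : Pruning {o, b, a₁, a₂, a₃} ends ends')
    (hx : x = o ∨ x = b ∨ x = a₁ ∨ x = a₂) (vs : List V) (es : List E)
    (h : PendantPath ends' none vs es x) (hm : ∀ v ∈ vs, v ≠ o ∧ v ≠ b ∧ v ≠ a₁ ∧ v ≠ a₂)
    (h3 : a₃ ∈ vs) : HCovTriple p ends o a₁ a₂ a₃ b :=
  (HCovTriple_pruning p hpr).1 (HCovTriple_pendantPath_marked p ends' hp hx vs es h hm a₃ h3)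

/-- **(HCOV) on pendant trees** (the (HCOV)-only statement). -/
theorem HCov_pruned_pendantPath_marked (hp : IsProbVec p) {ends ends' : E → Sym2 V}
    {o a₁ a₂ a₃ b x : V} (hpr : Pruning {o, b, a₁, a₂, a₃} ends ends')
    (hx : x = o ∨ x = b ∨ x = a₁ ∨ x = a₂) (vs : List V) (es : List E)
    (h : PendantPath ends' none vs es x) (hm : ∀ v ∈ vs, v ≠ o ∧ v ≠ b ∧ v ≠ a₁ ∧ v ≠ a₂)
    (h3 : a₃ ∈ vs) : HCov p ends o a₁ a₂ a₃ b :=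
  (HCovTriple_pruned_pendantPath_marked p hp hpr hx vs es h hm h3).1

end LeafDelete

end Summit.Ventures.PercRepro2
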